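import Literature.AlgebraicGeometry.Resolution.AlterationsLemma32
import Literature.AlgebraicGeometry.Resolution.AdicQuotient
import Mathlib.RingTheory.MvPowerSeries.Inverse
import HarnessLib

/-!
# The complete local ring of a semi-stable curve at a singular point of a fibre (de Jong 1996, 2.23 and 3.3)

Topic: `Literature/AlgebraicGeometry/Resolution`. The formal-local input of de Jong's §3
(Lemma 3.2 and 3.5, i.e. of the named facts `DeJong1996SemiStableCodimTwoModification`,
`AlterationsSemiStableCodimTwo.lean`, and `DeJong1996SemiStablePairIsNormalForm`,
`AlterationsNormalFormBlowup.lean`): the complete local rings of the total space of a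
semi-stable curve at the singular points of its fibres.

> "2.23. (Local description of (split) semi-stable curves.) Let `f : X → S` be a semi-stable
> curve with `S` Noetherian. Consider a point `x ∈ Sing(f)` and let `s = f(x)`. … Let `B` be
> the complete local ring of `X` at `x` and let `A` be the complete local ring of `S` at `s`. …
> By assumption of semi-stability we have that `B/𝔪_A B ≅ k'⟦u, v⟧/(q)` … By flatness of `B`
> over `A'`, we see that `B ≅ A'⟦u, v⟧/(Q - h)` for some `h ∈ 𝔪_{A'} A'⟦u, v⟧`. Rechoosing the
> coordinates `u, v ∈ B` appropriately, using that `discr(q) ≠ 0`, we see that we may assume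
> `h ∈ A'`. … If `f` is a split semi-stable curve, then `k = A'` [i.e. `A = A'`] and the
> quadratic form `q` splits over `k`. … Thus we may choose `q = uv` and `Q = uv`. The complete
> local ring of `X` at `x` is `B ≅ A⟦u, v⟧/(uv - h)` for some `h ∈ A`." (pp. 61–62)
>
> "3.3. Let us describe the local situation at a point `x ∈ Sing(X)` [`Sing(f)`]. Put
> `s = f(x) ∈ S`. … Suppose that `s` lies in the components `D₁, …, D_r` of `D` but not in any
> other component. Let `tᵢ ∈ 𝒪_{S,s}` be an element such that `V(tᵢ) = Dᵢ ∩ Spec 𝒪_{S,s}`.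
> Note that the elements `t₁, …, t_r` form [part of] a regular system of parameters of
> `𝒪_{S,s}`, hence also of `A` and `A'`. The singular locus of `f` traced on `Spec B` maps
> isomorphically to the closed subscheme `V(h) ⊂ Spec A'`. By assumption we have
> `V(h) ⊂ V(t₁ ⋯ t_r)`. Therefore we see that `h = ε t₁^{n₁} ⋯ t_r^{n_r}`, `ε ∈ (A')*` with
> `nᵢ ≥ 0` and `Σ nᵢ ≥ 2` (if `Σ nᵢ = 1`, then the point `x` is regular on `X`). We change `Q`
> into `ε⁻¹ Q`. Thus we have `B ≅ A'⟦u, v⟧/(Q - t₁^{n₁} ⋯ t_r^{n_r})`." (p. 63)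

This file

* defines the **model ring** `DeJong1996.NodeDeformationRing A h = A⟦u, v⟧/(uv - h)` with its
  structure map `NodeDeformationRing.ofBase : A → A⟦u, v⟧/(uv - h)`, and the **completed stalk
  map** `DeJong1996.completedStalkMap f x : 𝒪̂_{Y, f x} → 𝒪̂_{X, x}` of a morphism of schemes
  (Mathlib's `AdicCompletion` at the maximal ideals; `adicCompletionMap` of `AdicQuotient.lean`),
  with the lemmas `NodeDeformationRing.ofBase_apply`, `mk_X_mul_mk_X` (`u · v = h`),
  `NodeDeformationRing.isLocalRing` (a local ring for `A` local and `h ∈ 𝔪_A`),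
  `completedStalkMap_of`;
* vendors **2.23 with 3.3 in the split case** as ONE named fact `DeJong1996NodeLocalStructure`,
  for the curve `f : X → Y` of a pair in Situation 4.23 over an algebraically closed field `k`
  (`DeJong1996.SemiStablePair f g D τ`; `S = Y`) at a CLOSED point `x` of `X` not in the smooth
  locus of `f` (`x ∈ Sing(f)`; then `κ(x) = κ(f x) = k`, so the situation is split, 4.24: "there
  we consider only closed points, so that the situation is automatically split"): for every
  choice of local equations `t₁, …, t_r` of the branches of `D` at `s = f x` completed to a
  regular system of parameters (the local data of `IsStrictNormalCrossingsDivisor`), there are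
  exponents `n₁, …, n_r` and an isomorphism of `𝒪̂_{Y,s}`-algebras
  `𝒪̂_{X,x} ≅ 𝒪̂_{Y,s}⟦u, v⟧/(uv - t₁^{n₁} ⋯ t_r^{n_r})`, with `Σ nᵢ ≥ 1` and: `x` is a regular
  point of `X` iff `Σ nᵢ = 1`.

The fact is a node to decompose further (2.23: the completed local ring of the fibre is
`k⟦u, v⟧/(uv)` by 2.21, lifting the node relation by flatness, and the reduction `h ∈ A` —
"one may also prove this by showing that the minimal versal deformation space of the singularity
`k'⟦u, v⟧/(q)` is one-dimensional"; 3.3: `V(h) ⊆ V(t₁ ⋯ t_r)` from smoothness over `S ∖ D`, and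
unique factorisation in the regular `A`).

## Sources

* A. J. de Jong, *Smoothness, semi-stability and alterations*, Publ. Math. IHÉS 83 (1996),
  2.21–2.23 (pp. 61–62), 3.1–3.3 (pp. 62–63), 4.23–4.24 (p. 75).
-/

noncomputable section

open CategoryTheory CategoryTheory.Limits AlgebraicGeometry TopologicalSpace IsLocalRing

namespace Literature.AlgebraicGeometry.Resolution

universe u

namespace DeJong1996

/-! ## The model ring `A⟦u, v⟧/(uv - h)` -/

/-- The relation `uv - h ∈ A⟦u, v⟧` (`u = X 0`, `v = X 1`) of the local model of a semi-stable
curve at a singular point of a fibre (de Jong 1996, 2.23). [cite: DeJong1996, 2.23, p. 62] -/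
def nodeDeformationRelation (A : Type u) [CommRing A] (h : A) : MvPowerSeries (Fin 2) A :=
  MvPowerSeries.X 0 * MvPowerSeries.X 1 - MvPowerSeries.C h

/-- **The model ring `A⟦u, v⟧/(uv - h)`** of de Jong 1996, 2.23 ("The complete local ring of
`X` at `x` is `B ≅ A⟦u, v⟧/(uv - h)` for some `h ∈ A`"), for a commutative ring `A` and
`h ∈ A`: the quotient of `MvPowerSeries (Fin 2) A` by `uv - h`. [cite: DeJong1996, 2.23, p. 62] -/
abbrev NodeDeformationRing (A : Type u) [CommRing A] (h : A) : Type u :=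
  MvPowerSeries (Fin 2) A ⧸ Ideal.span {nodeDeformationRelation A h}

/-- The structure map `A → A⟦u, v⟧/(uv - h)` (constants). [cite: DeJong1996, 2.23, p. 62] -/
def NodeDeformationRing.ofBase (A : Type u) [CommRing A] (h : A) : A →+* NodeDeformationRing A h :=
  (Ideal.Quotient.mk _).comp MvPowerSeries.C

/-- Unfolding `NodeDeformationRing.ofBase`. [folklore] -/
@[simp] theorem NodeDeformationRing.ofBase_apply (A : Type u) [CommRing A] (h : A) (a : A) :
    NodeDeformationRing.ofBase A h a = Ideal.Quotient.mk _ (MvPowerSeries.C a) :=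
  rfl

/-- In `A⟦u, v⟧/(uv - h)` the relation `u · v = h` holds. [folklore] -/
theorem NodeDeformationRing.mk_X_mul_mk_X (A : Type u) [CommRing A] (h : A) :
    Ideal.Quotient.mk (Ideal.span {nodeDeformationRelation A h}) (MvPowerSeries.X 0) *
        Ideal.Quotient.mk (Ideal.span {nodeDeformationRelation A h}) (MvPowerSeries.X 1) =
      NodeDeformationRing.ofBase A h h := by
  rw [← map_mul, NodeDeformationRing.ofBase_apply, Ideal.Quotient.mk_eq_mk_iff_sub_mem]
  exact Ideal.subset_span rfl

/-- The relation `uv - h` is not a unit of `A⟦u, v⟧` when `h` is not a unit of `A` (its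
constant coefficient is `-h`). [folklore] -/
theorem not_isUnit_nodeDeformationRelation {A : Type u} [CommRing A] {h : A} (hh : ¬ IsUnit h) :
    ¬ IsUnit (nodeDeformationRelation A h) := by
  rw [MvPowerSeries.isUnit_iff_constantCoeff, nodeDeformationRelation, map_sub, map_mul,
    MvPowerSeries.constantCoeff_X, zero_mul, zero_sub, MvPowerSeries.constantCoeff_C, IsUnit.neg_iff]
  exact hh

/-- For a local ring `A` and `h ∈ 𝔪_A`, the model ring `A⟦u, v⟧/(uv - h)` is a (non-trivial)
local ring: a quotient of the local ring `A⟦u, v⟧` by a proper ideal. [folklore] -/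
theorem NodeDeformationRing.isLocalRing {A : Type u} [CommRing A] [IsLocalRing A] {h : A}
    (hh : h ∈ maximalIdeal A) : IsLocalRing (NodeDeformationRing A h) := by
  have hne : Ideal.span {nodeDeformationRelation A h} ≠ ⊤ := by
    rw [Ne, Ideal.span_singleton_eq_top]
    exact not_isUnit_nodeDeformationRelation hh
  haveI : Nontrivial (NodeDeformationRing A h) := Ideal.Quotient.nontrivial_iff.mpr hne
  exact IsLocalRing.of_surjective' (Ideal.Quotient.mk _) Ideal.Quotient.mk_surjective

/-! ## The completed stalk map -/

section CompletedStalkMap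

variable {X Y : Scheme.{u}} (f : X ⟶ Y) (x : X)

/-- The stalk map `𝒪_{Y, f x} → 𝒪_{X, x}` sends the maximal ideal into the maximal ideal (it
is a local homomorphism). [folklore] -/
theorem map_maximalIdeal_stalkMap_le :
    (maximalIdeal (Y.presheaf.stalk (f x))).map (f.stalkMap x).hom ≤
      maximalIdeal (X.presheaf.stalk x) :=
  IsLocalRing.map_maximalIdeal_le (f.stalkMap x).hom

/-- **The completed stalk map** `f̂^♯_x : 𝒪̂_{Y, f x} → 𝒪̂_{X, x}` of a morphism of schemes at
a point: the map induced by the local homomorphism `f^♯_x : 𝒪_{Y, f x} → 𝒪_{X, x}` on the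
adic completions at the maximal ideals (de Jong 1996, 2.23: "we get `A → A' → B`").
[cite: DeJong1996, 2.23, p. 61] -/
def completedStalkMap :
    AdicCompletion (maximalIdeal (Y.presheaf.stalk (f x))) (Y.presheaf.stalk (f x)) →+*
      AdicCompletion (maximalIdeal (X.presheaf.stalk x)) (X.presheaf.stalk x) :=
  adicCompletionMap _ _ (f.stalkMap x).hom (map_maximalIdeal_stalkMap_le f x)

/-- `completedStalkMap` extends the stalk map. [folklore] -/
@[simp] theorem completedStalkMap_of (a : Y.presheaf.stalk (f x)) :
    completedStalkMap f x (AdicCompletion.of _ _ a) =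
      AdicCompletion.of _ _ ((f.stalkMap x).hom a) :=
  adicCompletionMap_of _ _ _ _ a

end CompletedStalkMap

end DeJong1996

/-! ## 2.23 with 3.3 as a named fact -/

open Scheme.IdealSheafData in
/-- NAMED FACT — **de Jong 1996, 2.23 with 3.3 (split case): the complete local ring of a
semi-stable curve at a singular point of a fibre.** 2.23: "Let `f : X → S` be a semi-stable curve
with `S` Noetherian. Consider a point `x ∈ Sing(f)` and let `s = f(x)`. … Let `B` be the
complete local ring of `X` at `x` and let `A` be the complete local ring of `S` at `s`. … If `f`
is a split semi-stable curve … The complete local ring of `X` at `x` is `B ≅ A⟦u, v⟧/(uv - h)`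
for some `h ∈ A`." 3.3 (setting 3.1: `S` excellent regular, `D ⊂ S` a strict normal crossings
divisor, `f` smooth over `S ∖ D`): "Suppose that `s` lies in the components `D₁, …, D_r` of `D`
but not in any other component. Let `tᵢ ∈ 𝒪_{S,s}` be an element such that
`V(tᵢ) = Dᵢ ∩ Spec 𝒪_{S,s}`. Note that the elements `t₁, …, t_r` form [part of] a regular
system of parameters of `𝒪_{S,s}` … we see that `h = ε t₁^{n₁} ⋯ t_r^{n_r}`, `ε ∈ (A')*` with
`nᵢ ≥ 0` … (if `Σ nᵢ = 1`, then the point `x` is regular on `X`). We change `Q` into `ε⁻¹ Q`.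
Thus we have `B ≅ A'⟦u, v⟧/(Q - t₁^{n₁} ⋯ t_r^{n_r})`." Rendered for the curve `f : X → Y` of
a pair in Situation 4.23 (`DeJong1996.SemiStablePair f g D τ` over an algebraically closed `k`;
`S = Y`, a nonsingular variety, is excellent regular) at a CLOSED point `x` of `X` lying in no
open on which `f` is smooth (`x ∈ Sing(f)`, 2.21/3.1; `x` and `s = f x` are then `k`-rational,
so `A' = A`, `Q = uv`: "there we consider only closed points, so that the situation is
automatically split", 4.24; the unit `ε` is absorbed into `u`): for all local equations
`t : Fin r → 𝒪_{Y,s}` of the branches of `D` at `s` completed by `y : Fin e → 𝒪_{Y,s}` to a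
regular system of parameters (the local data of `IsStrictNormalCrossingsDivisor Y D` at `s`:
`r ≥ 1`, `dim 𝒪_{Y,s} = r + e`, `(t, y)` generate `𝔪_s`, `(I_D)_s = (t₁ ⋯ t_r)`), there are
exponents `n : Fin r → ℕ` and a ring isomorphism
`e : 𝒪̂_{X,x} ≅ 𝒪̂_{Y,s}⟦u, v⟧/(uv - t̂₁^{n₁} ⋯ t̂_r^{n_r})` (`NodeDeformationRing`, Mathlib's
`AdicCompletion`s at the maximal ideals, `t̂ᵢ` the image of `tᵢ`) compatible with the
completed stalk map `𝒪̂_{Y,s} → 𝒪̂_{X,x}` (`completedStalkMap`) and the structure map, such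
that `Σ nᵢ ≥ 1` (`h ∈ 𝔪_A`) and `𝒪_{X,x}` is regular iff `Σ nᵢ = 1`. Users take
`(h : DeJong1996NodeLocalStructure)`; it is a node to decompose further (2.21 ⇒ the completed
fibre ring `k⟦u, v⟧/(uv)`; lifting by flatness and `h ∈ A` via the versal deformation of the
node; `V(h) ⊆ V(t₁ ⋯ t_r)` by smoothness off `D`; unique factorisation in `A`).
[cite: DeJong1996, 2.23 and 3.3, pp. 61–63] -/
def DeJong1996NodeLocalStructure : Prop :=
  ∀ (k : Type u) [Field k] [IsAlgClosed k] (X Y : Scheme.{u}) (f : X ⟶ Y)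
    (g : Y ⟶ Spec (.of k)) (D : Set Y) (n : ℕ) (τ : Fin n → (Y ⟶ X)),
    DeJong1996.SemiStablePair f g D τ →
      ∀ x : X, IsClosed ({x} : Set X) → (∀ U : X.Opens, x ∈ U → ¬ Smooth (U.ι ≫ f)) →
        ∀ (r e : ℕ) (t : Fin r → Y.presheaf.stalk (f x)) (y : Fin e → Y.presheaf.stalk (f x)),
          1 ≤ r → ringKrullDim (Y.presheaf.stalk (f x)) = (r + e : ℕ) →
            Ideal.span (Set.range t ∪ Set.range y) = maximalIdeal (Y.presheaf.stalk (f x)) →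
              (∀ (U : Y.affineOpens) (hU : f x ∈ (U : Y.Opens)),
                ((vanishingIdeal ⟨closure D, isClosed_closure⟩).ideal U).map
                  (Y.presheaf.germ U (f x) hU).hom = Ideal.span {∏ i, t i}) →
                ∃ (m : Fin r → ℕ)
                  (e : AdicCompletion (maximalIdeal (X.presheaf.stalk x)) (X.presheaf.stalk x) ≃+*
                    DeJong1996.NodeDeformationRing
                      (AdicCompletion (maximalIdeal (Y.presheaf.stalk (f x)))
                        (Y.presheaf.stalk (f x)))
                      (∏ i, AdicCompletion.of _ _ (t i) ^ m i)),
                  e.toRingHom.comp (DeJong1996.completedStalkMap f x) =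
                      DeJong1996.NodeDeformationRing.ofBase _ _ ∧
                    1 ≤ ∑ i, m i ∧
                      (IsRegularLocalRing (X.presheaf.stalk x) ↔ ∑ i, m i = 1)

end Literature.AlgebraicGeometry.Resolution

end
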